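import Literature.AnabelianGeometry.EtaleTheta.KummerEquivarianceAction
import Literature.AnabelianGeometry.EtaleTheta.KummerMapFunctoriality
import Literature.AnabelianGeometry.EtaleTheta.CyclotomeAutZHat
import HarnessLib

/-!
# The `Ẑ^×`-module structure of the Kummer container `lim_{→ H} H¹(H, Λ(A))` and NATURALITY of the
# Kummer map under automorphisms of the pair (LANA §6.1; classical)

Source: LANA Project interim report [LANA2026Report], §6.1 "Generalities on Kummer maps", pp. 31–32:
`Λ(M) := lim_n M^gp[n]` "considered as a (topological) `G`-module", the Kummer map
`κ : M → lim_{→ H} H¹(H, Λ(M))`, and its functoriality square for a co-morphism `(φ_*, φ^*)`.  Classical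
background for `Ẑ^× = Aut(Ẑ)` acting on every cyclotome: [RibesZalesskii2010, Thm 2.7.1].

**What was in the tree** (abc-iut cell, L2 Kummer lane + classical bricks): `kummerMap`, `H1Colimit`,
`CoMorphism.colimMap` / `colimMap_kummerMap` (functoriality square on the colimits), the `G`-ACTION
`CoMorphism.conjColimMap` / `conjColimMulAut` (`KummerEquivarianceAction.lean`); the `Ẑ^×`-action
`cyclotome.zhatTwist A : Aut(Ẑ) →* Aut(Λ(A))` on the cyclotome itself (`CyclotomeZHatAction.lean`), and
`cyclotome.existsUnique_zhatTwist_eq_map` (every automorphism of `R^×`, `R` a domain with all roots of unity, acts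
on `Λ(R^×)` through a unique `u ∈ Ẑ^×` — its cyclotomic character; `CyclotomeAutZHat.lean`).

**What this file adds** (post-freeze ADDITIVE; new module, not a cone member):
* `cyclotomeRepTwist H u` — the twist by `u ∈ Ẑ^× = Aut(Ẑ)` as an endomorphism of the `H`-module `Λ(A)`
  (Mathlib `Rep`; equivariance = `cyclotome.smul_zhatTwist`);
* `H1Twist H u := H¹(id_H, twist_u) : H¹(H, Λ(A)) → H¹(H, Λ(A))` (Mathlib `groupCohomology.map`), with
  `H1Twist_one_apply`, `H1Twist_mul_apply`, `resH1_H1Twist` (commutes with restriction);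
* `H1ColimTwist S hS u : lim_{→ i} H¹(S i, Λ(A)) →+ lim_{→ i} H¹(S i, Λ(A))` — descent to the direct limit —
  with `H1ColimTwist_one_apply`, `H1ColimTwist_mul_apply`, the automorphism form `H1ColimTwistEquiv`, the
  homomorphism `H1ColimTwistMulAut : Aut(Ẑ) →* MulAut (Multiplicative _)` and the `MulAction` structure
  `zhatMulAction` — **the `Ẑ^×`-MODULE STRUCTURE of the Kummer container**;
* `CoMorphism.ofEquivariant e he` — a `G`-equivariant endomorphism `e` of `A` as the co-morphism `(id_G, e)` — and
  THE KEY LEMMA `colimMap_ofEquivariant_eq_H1ColimTwist`: if `Λ(e)` is the twist by `u` (`∀ ζ, Λ(e) ζ = u · ζ`),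
  then the induced map of containers IS the twist by `u` (`groupCohomology.map_congr`: the two `Rep`-maps agree);
* **`kummerMap_equivariant_eq_twist`**: consequently `κ(e a) = u · κ(a)` for all `a` — the NATURALITY OF THE
  KUMMER MAP UNDER AUTOMORPHISMS OF THE PAIR `G ↷ A` (law (a) of [IUTchI] Ex. 5.1 (v), GAP-LEDGER G-w4d056-2,
  hypothesis `hnat` of `CoricPair.kummerRigid_of_divisors`), and `kummerMap_units_equivariant_eq_twist`: for
  `A = R^×` (`R` a domain with primitive roots of unity of every order) the twisting element EXISTS for every
  `G`-equivariant automorphism — its cyclotomic character.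

HONEST FRAMING: classical module bookkeeping over Mathlib's group cohomology; OUR kernel check; nothing here bears
on [IUTchIII] Cor. 3.12; no statement of the disputed series is asserted.  Groups and modules live in `Type`
(Mathlib's `groupCohomology` is single-universe), as in the landed Kummer files.
-/

noncomputable section

open CategoryTheory groupCohomology ProfiniteGrp ProfiniteGrp.ProfiniteCompletion

namespace Literature.AnabelianGeometry.EtaleTheta

/-! ## Level `H`: the twist by `u ∈ Ẑ^×` on `H¹(H, Λ(A))` -/

section Level

variable {G : Type} [Group G] {A : Type} [CommGroup A] [MulDistribMulAction G A] (H : Subgroup G)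

/-- The twist by `u ∈ Ẑ^× = Aut(Ẑ)` as an endomorphism of the `H`-module `Λ(A)` (it commutes with the `G`-action,
`cyclotome.smul_zhatTwist`). [cite: LANA2026Report, §6.1 p.31] -/
def cyclotomeRepTwist (u : MulAut (completion (GrpCat.of (Multiplicative ℤ)))) :
    Rep.res (MonoidHom.id H) (cyclotomeRep (A := A) H) ⟶ cyclotomeRep (A := A) H :=
  Rep.ofHom
    { toLinearMap := (MonoidHom.toAdditive (cyclotome.zhatTwist A u).toMonoidHom).toIntLinearMap
      isIntertwining' := fun γ =>
        LinearMap.ext fun v =>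
          (cyclotome.smul_zhatTwist (γ : G) u (Additive.toMul (α := cyclotome A) v)).symm }

/-- `cyclotomeRepTwist` on elements. [cite: LANA2026Report, §6.1 p.31] -/
@[simp] theorem cyclotomeRepTwist_hom_apply (u : MulAut (completion (GrpCat.of (Multiplicative ℤ))))
    (v : Additive (cyclotome A)) :
    (cyclotomeRepTwist (A := A) H u).hom v = Additive.ofMul (cyclotome.zhatTwist A u v.toMul) := rfl

/-- **The twist `H¹(H, Λ(A)) → H¹(H, Λ(A))` by `u ∈ Ẑ^×`** (functoriality of `H¹` in the coefficient automorphism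
`u · (−)` of `Λ(A)`, Mathlib `groupCohomology.map`). [cite: LANA2026Report, §6.1 p.31] -/
abbrev H1Twist (u : MulAut (completion (GrpCat.of (Multiplicative ℤ)))) :
    H1 (cyclotomeRep (A := A) H) ⟶ H1 (cyclotomeRep (A := A) H) :=
  groupCohomology.map (MonoidHom.id H) (cyclotomeRepTwist (A := A) H u) 1

/-- `1 ∈ Ẑ^×` twists trivially. [cite: LANA2026Report, §6.1 p.31] -/
theorem H1Twist_one : H1Twist (A := A) H 1 = 𝟙 _ := by
  rw [H1Twist, ← groupCohomology.map_id]
  exact groupCohomology.map_congr rfl (LinearMap.ext fun v => by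
    change Additive.ofMul (cyclotome.zhatTwist A 1 v.toMul) = v
    rw [map_one, MulAut.one_apply]; rfl) 1

/-- `1 ∈ Ẑ^×` twists trivially (on elements). [cite: LANA2026Report, §6.1 p.31] -/
theorem H1Twist_one_apply (x : H1 (cyclotomeRep (A := A) H)) : H1Twist (A := A) H 1 x = x := by
  rw [H1Twist_one]; rfl

/-- The twists compose: `(u v) · x = u · (v · x)` on `H¹(H, Λ(A))`. [cite: LANA2026Report, §6.1 p.31] -/
theorem H1Twist_mul (u v : MulAut (completion (GrpCat.of (Multiplicative ℤ)))) :
    H1Twist (A := A) H (u * v) = H1Twist (A := A) H v ≫ H1Twist (A := A) H u := by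
  rw [H1Twist, H1Twist, H1Twist, ← groupCohomology.map_id_comp]
  exact groupCohomology.map_congr rfl (LinearMap.ext fun w => by
    change Additive.ofMul (cyclotome.zhatTwist A (u * v) w.toMul) =
      Additive.ofMul (cyclotome.zhatTwist A u (cyclotome.zhatTwist A v w.toMul))
    rw [map_mul, MulAut.mul_apply]) 1

/-- The twists compose (on elements). [cite: LANA2026Report, §6.1 p.31] -/
theorem H1Twist_mul_apply (u v : MulAut (completion (GrpCat.of (Multiplicative ℤ))))
    (x : H1 (cyclotomeRep (A := A) H)) :
    H1Twist (A := A) H (u * v) x = H1Twist (A := A) H u (H1Twist (A := A) H v x) := by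
  rw [H1Twist_mul]; rfl

/-- **The twist commutes with restriction** `H¹(H, Λ(A)) → H¹(H', Λ(A))`, `H' ≤ H` (both are instances of
`groupCohomology.map`; the composites agree by `map_congr`). [cite: LANA2026Report, §6.1 p.31] -/
theorem resH1_H1Twist {H H' : Subgroup G} (h : H' ≤ H) (u : MulAut (completion (GrpCat.of (Multiplicative ℤ))))
    (x : H1 (cyclotomeRep (A := A) H)) :
    resH1 h (H1Twist (A := A) H u x) = H1Twist (A := A) H' u (resH1 h x) := by
  have e₁ : H1Twist (A := A) H u ≫ (CoMorphism.refl G A).H1Map (CoMorphism.refl_cond h) =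
      (CoMorphism.refl G A).H1Map (CoMorphism.refl_cond h) ≫ H1Twist (A := A) H' u := by
    rw [H1Twist, H1Twist, CoMorphism.H1Map, ← groupCohomology.map_comp, ← groupCohomology.map_comp]
    exact groupCohomology.map_congr (MonoidHom.ext fun _ => Subtype.ext rfl) (LinearMap.ext fun _ => rfl) 1
  change ((CoMorphism.refl G A).H1Map (CoMorphism.refl_cond h)).hom ((H1Twist (A := A) H u).hom x) =
    (H1Twist (A := A) H' u).hom (((CoMorphism.refl G A).H1Map (CoMorphism.refl_cond h)).hom x)
  rw [← ModuleCat.comp_apply, ← ModuleCat.comp_apply, e₁]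

end Level

/-! ## The colimit: the `Ẑ^×`-module structure of `lim_{→ i} H¹(S i, Λ(A))` -/

section Colim

variable {G : Type} [Group G] {A : Type} [CommGroup A] [MulDistribMulAction G A]
  {ι : Type} [Preorder ι] [DecidableEq ι] (S : ι → Subgroup G)
  (hS : ∀ ⦃i j : ι⦄, i ≤ j → S j ≤ S i)

/-- Level-wise pieces of the twist on the colimit: `H¹(S i, Λ A) → H¹(S i, Λ A) → lim_{→}`.
[cite: LANA2026Report, §6.1 p.31] -/
def H1ColimTwistAux (u : MulAut (completion (GrpCat.of (Multiplicative ℤ)))) (i : ι) :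
    H1 (cyclotomeRep (A := A) (S i)) →+ H1Colimit A S hS :=
  (toColimit (A := A) S hS i).comp (H1Twist (A := A) (S i) u).hom.toAddMonoidHom

/-- The level-wise twists are compatible with the transition (restriction) maps, so they descend to the
direct limit. [cite: LANA2026Report, §6.1 p.31] -/
theorem H1ColimTwist_compat (u : MulAut (completion (GrpCat.of (Multiplicative ℤ)))) (i j : ι) (hij : i ≤ j)
    (x : H1 (cyclotomeRep (A := A) (S i))) :
    H1ColimTwistAux S hS u j (H1System (A := A) S hS i j hij x) = H1ColimTwistAux S hS u i x := by
  change toColimit S hS j (H1Twist (A := A) (S j) u (resH1 (hS hij) x)) =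
    toColimit S hS i (H1Twist (A := A) (S i) u x)
  rw [← resH1_H1Twist (hS hij) u x]
  exact AddCommGroup.DirectLimit.of_f (f := H1System (A := A) S hS) hij _

/-- **The twist by `u ∈ Ẑ^×` on the Kummer container** `lim_{→ i} H¹(S i, Λ(A))`.
[cite: LANA2026Report, §6.1 p.31] -/
def H1ColimTwist (u : MulAut (completion (GrpCat.of (Multiplicative ℤ)))) : H1Colimit A S hS →+ H1Colimit A S hS :=
  AddCommGroup.DirectLimit.lift (fun i => H1 (cyclotomeRep (A := A) (S i))) (H1System (A := A) S hS)
    _ (H1ColimTwistAux S hS u) (H1ColimTwist_compat S hS u)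

/-- `H1ColimTwist u` on the image of a level-`i` class is the level-`i` twist. [cite: LANA2026Report, §6.1 p.31] -/
theorem H1ColimTwist_toColimit (u : MulAut (completion (GrpCat.of (Multiplicative ℤ)))) (i : ι)
    (x : H1 (cyclotomeRep (A := A) (S i))) :
    H1ColimTwist S hS u (toColimit S hS i x) = toColimit S hS i (H1Twist (A := A) (S i) u x) :=
  AddCommGroup.DirectLimit.lift_of _ (H1ColimTwistAux S hS u) (H1ColimTwist_compat S hS u) i x

variable [IsDirectedOrder ι] [Nonempty ι]

/-- **`1 ∈ Ẑ^×` acts as the identity** on the container. [cite: LANA2026Report, §6.1 p.31] -/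
theorem H1ColimTwist_one_apply (z : H1Colimit A S hS) : H1ColimTwist S hS 1 z = z := by
  induction z using AddCommGroup.DirectLimit.induction_on with
  | ih i x => rw [H1ColimTwist_toColimit, H1Twist_one_apply]

/-- **`(u v)` acts as `u` after `v`** on the container (a LEFT action of `Ẑ^×`). [cite: LANA2026Report, §6.1 p.31] -/
theorem H1ColimTwist_mul_apply (u v : MulAut (completion (GrpCat.of (Multiplicative ℤ)))) (z : H1Colimit A S hS) :
    H1ColimTwist S hS (u * v) z = H1ColimTwist S hS u (H1ColimTwist S hS v z) := by
  induction z using AddCommGroup.DirectLimit.induction_on with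
  | ih i x => rw [H1ColimTwist_toColimit, H1ColimTwist_toColimit, H1ColimTwist_toColimit, H1Twist_mul_apply]

/-- The twist by `u ∈ Ẑ^×` as a group AUTOMORPHISM of the container (inverse: the twist by `u⁻¹`).
[cite: LANA2026Report, §6.1 p.31] -/
def H1ColimTwistEquiv (u : MulAut (completion (GrpCat.of (Multiplicative ℤ)))) : H1Colimit A S hS ≃+ H1Colimit A S hS :=
  { H1ColimTwist S hS u with
    invFun := H1ColimTwist S hS u⁻¹
    left_inv := fun z => by
      change H1ColimTwist S hS u⁻¹ (H1ColimTwist S hS u z) = z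
      rw [← H1ColimTwist_mul_apply, inv_mul_cancel, H1ColimTwist_one_apply]
    right_inv := fun z => by
      change H1ColimTwist S hS u (H1ColimTwist S hS u⁻¹ z) = z
      rw [← H1ColimTwist_mul_apply, mul_inv_cancel, H1ColimTwist_one_apply] }

/-- `H1ColimTwistEquiv u` is `H1ColimTwist u` on elements. [cite: LANA2026Report, §6.1 p.31] -/
@[simp] theorem H1ColimTwistEquiv_apply (u : MulAut (completion (GrpCat.of (Multiplicative ℤ)))) (z : H1Colimit A S hS) :
    H1ColimTwistEquiv S hS u z = H1ColimTwist S hS u z := rfl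

/-- **The `Ẑ^×`-MODULE STRUCTURE of the Kummer container** as a homomorphism
`Ẑ^× = Aut(Ẑ) →* MulAut (Multiplicative (lim_{→} H¹(S i, Λ A)))` (multiplicatively written container, the shape
of `CoMorphism.conjColimMulAut`). [cite: LANA2026Report, §6.1 p.31] -/
def H1ColimTwistMulAut :
    MulAut (completion (GrpCat.of (Multiplicative ℤ))) →* MulAut (Multiplicative (H1Colimit A S hS)) where
  toFun u := AddEquiv.toMultiplicative (H1ColimTwistEquiv S hS u)
  map_one' := MulEquiv.ext fun z => congrArg Multiplicative.ofAdd (H1ColimTwist_one_apply S hS z.toAdd)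
  map_mul' u v := MulEquiv.ext fun z =>
    congrArg Multiplicative.ofAdd (H1ColimTwist_mul_apply S hS u v z.toAdd)

/-- `H1ColimTwistMulAut u` on elements. [cite: LANA2026Report, §6.1 p.31] -/
@[simp] theorem H1ColimTwistMulAut_apply (u : MulAut (completion (GrpCat.of (Multiplicative ℤ))))
    (z : Multiplicative (H1Colimit A S hS)) :
    H1ColimTwistMulAut S hS u z = Multiplicative.ofAdd (H1ColimTwist S hS u z.toAdd) := rfl

/-- The same structure as a `MulAction` of `Ẑ^× = Aut(Ẑ)` on the (additively written) container — the
`[MulAction (MulAut Ẑ) H]` that [IUTchI] Ex. 5.1 (v)'s law (a) quantifies over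
(`CoricPair.kummerRigid_of_divisors`); a `def` (use with `letI`), not an instance.
[cite: LANA2026Report, §6.1 p.31] -/
@[reducible] def zhatMulAction : MulAction (MulAut (completion (GrpCat.of (Multiplicative ℤ)))) (H1Colimit A S hS) where
  smul u z := H1ColimTwist S hS u z
  one_smul z := H1ColimTwist_one_apply S hS z
  mul_smul u v z := H1ColimTwist_mul_apply S hS u v z

/-- Unfolding `zhatMulAction`: `u • z = H1ColimTwist u z`. [cite: LANA2026Report, §6.1 p.31] -/
theorem zhatMulAction_smul (u : MulAut (completion (GrpCat.of (Multiplicative ℤ)))) (z : H1Colimit A S hS) :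
    (letI := zhatMulAction (A := A) S hS; u • z) = H1ColimTwist S hS u z := rfl

/-- The `Ẑ^×`-twists COMMUTE with the natural `G`-action on the container (system of normal subgroups):
both are `groupCohomology.map`s and the coefficient twist is `G`-equivariant. [cite: LANA2026Report, §6.1 p.31] -/
theorem H1ColimTwist_conjColimMap [hN : ∀ i, (S i).Normal] (u : MulAut (completion (GrpCat.of (Multiplicative ℤ))))
    (g : G) (z : H1Colimit A S hS) :
    H1ColimTwist S hS u (CoMorphism.conjColimMap S hS g z) =
      CoMorphism.conjColimMap S hS g (H1ColimTwist S hS u z) := by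
  induction z using AddCommGroup.DirectLimit.induction_on with
  | ih i x =>
    rw [CoMorphism.conjColimMap_toColimit, H1ColimTwist_toColimit, H1ColimTwist_toColimit,
      CoMorphism.conjColimMap_toColimit]
    congr 1
    have e₁ : CoMorphism.conjAct (A := A) (S i) g ≫ H1Twist (A := A) (S i) u =
        H1Twist (A := A) (S i) u ≫ CoMorphism.conjAct (A := A) (S i) g := by
      rw [CoMorphism.conjAct, H1Twist, CoMorphism.H1Map, ← groupCohomology.map_comp,
        ← groupCohomology.map_comp]
      exact groupCohomology.map_congr (MonoidHom.ext fun _ => Subtype.ext rfl)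
        (LinearMap.ext fun w => by
          change Additive.ofMul (cyclotome.zhatTwist A u (cyclotome.map (CoMorphism.conj G A g).map w.toMul)) =
            Additive.ofMul (cyclotome.map (CoMorphism.conj G A g).map (cyclotome.zhatTwist A u w.toMul))
          rw [cyclotome.map_zhatTwist]) 1
    change (H1Twist (A := A) (S i) u).hom ((CoMorphism.conjAct (A := A) (S i) g).hom x) =
      (CoMorphism.conjAct (A := A) (S i) g).hom ((H1Twist (A := A) (S i) u).hom x)
    rw [← ModuleCat.comp_apply, ← ModuleCat.comp_apply, e₁]

end Colim

/-! ## Naturality of the Kummer map under automorphisms of the pair `G ↷ A` -/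

namespace CoMorphism

section Equivariant

variable (G A : Type*) [Group G] [CommGroup A] [MulDistribMulAction G A]

/-- A `G`-EQUIVARIANT endomorphism `e` of `A` as the co-morphism `(id_G, e) : (G, A) → (G, A)`
[an automorphism of the pair `G ↷ A` in the sense of [IUTchI] Ex. 5.1 (v)]. [cite: LANA2026Report, §6.1 p.32] -/
def ofEquivariant (e : A →* A) (he : ∀ (g : G) (a : A), e (g • a) = g • e a) : CoMorphism G A G A where
  groupHom := MonoidHom.id G
  map := e
  map_smul := he

variable {G A}

/-- `(ofEquivariant e).map = e`. [cite: LANA2026Report, §6.1 p.32] -/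
@[simp] theorem ofEquivariant_map (e : A →* A) (he : ∀ (g : G) (a : A), e (g • a) = g • e a) :
    (ofEquivariant G A e he).map = e := rfl

/-- `(ofEquivariant e).groupHom = id`. [cite: LANA2026Report, §6.1 p.32] -/
@[simp] theorem ofEquivariant_groupHom (e : A →* A) (he : ∀ (g : G) (a : A), e (g • a) = g • e a) :
    (ofEquivariant G A e he).groupHom = MonoidHom.id G := rfl

/-- The system condition for `(id_G, e)` relating every level to itself is trivial. [cite: LANA2026Report, §6.1 p.32] -/
theorem ofEquivariant_cond (e : A →* A) (he : ∀ (g : G) (a : A), e (g • a) = g • e a) (H : Subgroup G) :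
    H.map (ofEquivariant G A e he).groupHom ≤ H := by
  change H.map (MonoidHom.id G) ≤ H
  rw [Subgroup.map_id]

end Equivariant

section Naturality

variable {G : Type} [Group G] {A : Type} [CommGroup A] [MulDistribMulAction G A]
  {ι : Type} [Preorder ι] [DecidableEq ι] [IsDirectedOrder ι] (S : ι → Subgroup G)
  (hS : ∀ ⦃i j : ι⦄, i ≤ j → S j ≤ S i)

/-- **KEY LEMMA (level `H`).**  If the `G`-equivariant endomorphism `e` of `A` acts on the cyclotome as the twist
by `u ∈ Ẑ^×` (`Λ(e) = u · (−)`; for `A = R^×` this `u` is the cyclotomic character of `e`,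
`cyclotome.existsUnique_zhatTwist_eq_map`), then the `H¹`-map of the co-morphism `(id, e)` IS the twist by `u`
(`groupCohomology.map_congr`: same group homomorphism, same coefficient map). [cite: LANA2026Report, §6.1 p.32] -/
theorem H1Map_ofEquivariant_eq_H1Twist (e : A →* A) (he : ∀ (g : G) (a : A), e (g • a) = g • e a)
    (u : MulAut (completion (GrpCat.of (Multiplicative ℤ))))
    (hΛ : ∀ ζ : cyclotome A, cyclotome.map e ζ = cyclotome.zhatTwist A u ζ) (H : Subgroup G) :
    (ofEquivariant G A e he).H1Map (ofEquivariant_cond e he H) = H1Twist (A := A) H u :=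
  groupCohomology.map_congr (MonoidHom.ext fun _ => Subtype.ext rfl)
    (LinearMap.ext fun v => congrArg Additive.ofMul (hΛ (Additive.toMul v))) 1

/-- **KEY LEMMA (colimit).**  Under the same hypothesis the induced map of Kummer containers
`lim_{→} H¹(S i, Λ A) → lim_{→} H¹(S i, Λ A)` of `(id, e)` IS the container twist `H1ColimTwist u`.
[cite: LANA2026Report, §6.1 p.32] -/
theorem colimMap_ofEquivariant_eq_H1ColimTwist [Nonempty ι] (e : A →* A)
    (he : ∀ (g : G) (a : A), e (g • a) = g • e a) (u : MulAut (completion (GrpCat.of (Multiplicative ℤ))))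
    (hΛ : ∀ ζ : cyclotome A, cyclotome.map e ζ = cyclotome.zhatTwist A u ζ) (z : H1Colimit A S hS) :
    (ofEquivariant G A e he).colimMap S hS S hS id (fun i => ofEquivariant_cond e he (S i)) z =
      H1ColimTwist S hS u z := by
  induction z using AddCommGroup.DirectLimit.induction_on with
  | ih i x =>
    rw [colimMap_toColimit, H1ColimTwist_toColimit]
    change toColimit S hS i ((ofEquivariant G A e he).H1Map (ofEquivariant_cond e he (S i)) x) = _
    rw [H1Map_ofEquivariant_eq_H1Twist e he u hΛ (S i)]

variable [RootableBy A ℕ]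

/-- **NATURALITY OF THE KUMMER MAP UNDER AUTOMORPHISMS OF THE PAIR** ([IUTchI] Ex. 5.1 (v) law (a),
GAP-LEDGER G-w4d056-2; hypothesis `hnat` of `CoricPair.kummerRigid_of_divisors`): for a `G`-equivariant
endomorphism `e` of `A` acting on `Λ(A)` as the twist by `u ∈ Ẑ^×`, the Kummer map satisfies
`κ(e a) = u · κ(a)` for every `a ∈ A` — the functoriality square of the co-morphism `(id, e)`
(`colimMap_kummerMap`) read through the key lemma. [cite: LANA2026Report, §6.1 p.32] -/
theorem kummerMap_equivariant_eq_twist [Nonempty ι] (hc : IsExhausted A S) (e : A →* A)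
    (he : ∀ (g : G) (a : A), e (g • a) = g • e a) (u : MulAut (completion (GrpCat.of (Multiplicative ℤ))))
    (hΛ : ∀ ζ : cyclotome A, cyclotome.map e ζ = cyclotome.zhatTwist A u ζ) (a : A) :
    kummerMap hS hc (e a) = H1ColimTwist S hS u (kummerMap hS hc a) := by
  rw [← colimMap_ofEquivariant_eq_H1ColimTwist S hS e he u hΛ]
  exact ((ofEquivariant G A e he).colimMap_kummerMap S hS S hS id
    (fun i => ofEquivariant_cond e he (S i)) hc hc a).symm

/-- The same in the `MulAction` notation of `zhatMulAction`: `κ(e a) = u • κ(a)`. [cite: LANA2026Report, §6.1 p.32] -/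
theorem kummerMap_equivariant_eq_smul [Nonempty ι] (hc : IsExhausted A S) (e : A →* A)
    (he : ∀ (g : G) (a : A), e (g • a) = g • e a) (u : MulAut (completion (GrpCat.of (Multiplicative ℤ))))
    (hΛ : ∀ ζ : cyclotome A, cyclotome.map e ζ = cyclotome.zhatTwist A u ζ) (a : A) :
    kummerMap hS hc (e a) = (letI := zhatMulAction (A := A) S hS; u • kummerMap hS hc a) :=
  kummerMap_equivariant_eq_twist S hS hc e he u hΛ a

end Naturality

section Units

variable {G : Type} [Group G] {R : Type} [CommRing R] [IsDomain R] [MulDistribMulAction G Rˣ]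
  [RootableBy Rˣ ℕ] {ι : Type} [Preorder ι] [DecidableEq ι] [IsDirectedOrder ι] [Nonempty ι]
  (S : ι → Subgroup G) (hS : ∀ ⦃i j : ι⦄, i ≤ j → S j ≤ S i)

/-- **Law (a) of [IUTchI] Ex. 5.1 (v) at the REAL Kummer map, unconditionally in `u`**: for `A = R^×`, `R` a
domain with a primitive `n`-th root of unity for every `n ≥ 1` (e.g. `K̄^×`), EVERY `G`-equivariant automorphism
`e` of `R^×` acts on Kummer classes through an element of `Ẑ^×` — its cyclotomic character
(`cyclotome.existsUnique_zhatTwist_eq_map`): `∃ u, (Λ(e) = u · (−)) ∧ ∀ a, κ(e a) = u · κ(a)`.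
[cite: LANA2026Report, §6.1 p.32] -/
theorem kummerMap_units_equivariant_eq_twist (hprim : ∀ n : ℕ, 0 < n → ∃ ζ : R, IsPrimitiveRoot ζ n)
    (hc : IsExhausted Rˣ S) (e : Rˣ ≃* Rˣ) (he : ∀ (g : G) (a : Rˣ), e (g • a) = g • e a) :
    ∃ u : MulAut (completion (GrpCat.of (Multiplicative ℤ))),
      (∀ ζ : cyclotome Rˣ, cyclotome.map e.toMonoidHom ζ = cyclotome.zhatTwist Rˣ u ζ) ∧
      ∀ a : Rˣ, kummerMap hS hc (e a) = H1ColimTwist S hS u (kummerMap hS hc a) := by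
  obtain ⟨u, hu, -⟩ := cyclotome.existsUnique_zhatTwist_eq_map hprim e
  exact ⟨u, hu, fun a => kummerMap_equivariant_eq_twist S hS hc e.toMonoidHom he u hu a⟩

end Units

end CoMorphism

end Literature.AnabelianGeometry.EtaleTheta

end
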